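import Literature.NumberTheory.EllipticCurves.HeegnerPointsKolyvaginSplitDescentData
import Literature.NumberTheory.EllipticCurves.HeegnerPointsKolyvaginSplitDescentPairProofs
import HarnessLib

/-!
# Kolyvagin's descent modulo `p^M` for a PAIR, the DATA carrier (`PairDataM`), and its split data
# on the product (`PairDataM.toSplitData : SplitDataM (V₁ × V₂) Pl`)

Companion of `HeegnerPointsKolyvaginSplitDescentData` (`KolyvaginDescent.SplitDataM`: the split
descent data on ONE carrier without the analytic axioms) and of
`HeegnerPointsKolyvaginSplitDescentPairProofs` (`KolyvaginDescent.PairHypothesesM`: two members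
`V₁`, `V₂` — at `p = 2` the pair `(E^{ε}, E^{−ε})` over `ℚ` of Kolyvagin, Izv. 1989 §3 — WITH the
axioms `duality₁/₂` and `cebotarev`).

WHY THIS FILE. The adaptive Cassels–Tate telescope of the BSD route `CMKolyvaginAtInertTwo` (crux
`CMKolyvaginExactAtInertTwo`, seats `bsd-line-cmk2-p1` g12–g17) is a theorem about an abstract
`S : SplitDataM V Pl` mapped injectively into the eigen-pair over `K`; its intended carrier at `2` is
the `ℚ`-pair `V = H¹(ℚ, E[2^M]) × H¹(ℚ, E^{(d_K)}[2^M])` with Kolyvagin's classes placed by the parity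
of their depth. The record `PairHypothesesM` cannot be instantiated there (its field `cebotarev` —
Cor. 3.2 for independent pure families in kernel form — is unsatisfiable at `2`, exactly like
`SplitHypothesesM.cebotarev`, see the module docstring of `…SplitDescentData`), so this file provides
the bare two-member data and the passage to the product:

* `KolyvaginDescent.PairDataM V₁ V₂ Pl` — `PairHypothesesM` with the fields `duality₁`, `duality₂`,
  `cebotarev` REMOVED (everything else verbatim: prime and level, the two Selmer groups with their
  local conditions, Kolyvagin primes with place / divisibility / strict conditions, the class `x` of
  order `p^M` on the first member, `M₀`, the classes `c₁` (even depth) / `c₂` (odd depth) with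
  McCallum's Lemma 4.3 on each member and Prop. 4.4 ACROSS the members);
* `PairDataM.eig` — the sign-indexed parts of the product: `V₁ × 0` at `1`, `0 × V₂` at `−1`, `⊥`
  at every other integer (so that they match eigengroups defined the same way on a target);
* `PairDataM.toSplitData : SplitDataM (V₁ × V₂) Pl` — `Sel = Sel₁ × Sel₂`, `Loc v = Loc₁ v × Loc₂ v`,
  `A ℓ = A₁ ℓ × A₂ ℓ`, `ε = 1`, `x = (x, 0)`, `c = pairClass c₁ c₂`; the tags of `x` and `c(n)`
  (Gross Prop. 5.4 (2)) hold BY CONSTRUCTION, Lemma 4.3 / Prop. 4.4 are the members' fields read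
  through the parity of the depth (as in `PairHypothesesM`/`VisiblePairHypothesesM.toVisibleSplit`);
* unfolding lemmas (`toSplitData_p`, `…_M`, `…_M₀`, `…_ε`, `…_x`, `…_Kol`, `mem_toSplitData_sel_iff`,
  `mem_toSplitData_A_iff`, `mem_toSplitData_eig_iff_*`, `toSplitData_c_of_even/odd`);
* `PairHypothesesM.toData` — the forgetful map.

No theorem of substance, no named fact; nothing here is a claim about BSD.

## References

* V. A. Kolyvagin, *On the Mordell–Weil group and the Shafarevich–Tate group of modular elliptic
  curves*, Izv. 1989: Thm. `B_l` at `l = 2`, §3 (the pair `(E, E^D)` over `ℚ`). [Kolyvagin1989Izv]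
* W. G. McCallum, *Kolyvagin's work on Shafarevich–Tate groups*, LMS Lecture Note Ser. 153 (1991)
  295–316: §§3–5 (Cor. 3.2, Lemma 4.3, Prop. 4.4, Lemma 5.1, Lemma 5.3). [McCallumLMS1991]
* B. H. Gross, *Kolyvagin's work on modular elliptic curves*, same volume: Prop. 5.4 (2). [GrossLMS1991]
-/

noncomputable section

open scoped Classical

namespace Literature.NumberTheory.EllipticCurves

namespace KolyvaginDescent

/-! ## The two-member data carrier -/

/-- **Kolyvagin's descent modulo `p^M` for a pair, the DATA** (any prime `p`, `2` allowed): the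
record `PairHypothesesM` WITHOUT its analytic axioms `duality₁`, `duality₂`, `cebotarev`. Two abelian
groups `V₁`, `V₂` killed by `p^M` (at `p = 2`: `H¹(ℚ, E^{ε}[2^M])`, `H¹(ℚ, E^{-ε}[2^M])`, `E^{ε}` the
member carrying the Heegner class); Selmer groups `Selᵢ ≤ Vᵢ` cut out by local conditions `Locᵢ v`;
Kolyvagin primes `Kol ℓ` with place `pl ℓ`, divisibility `Dv` and strict conditions `Aᵢ ℓ`;
`x ∈ Sel₁` of order `p^M`, `M₀` with `c₁ 1 = p^{M₀} x` (McCallum Lemma 5.1); classes `c₁ n` (even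
depth) / `c₂ n` (odd depth) with McCallum's Lemma 4.3 on each member (`c_mem_loc₁/₂`) and Prop. 4.4
ACROSS the members (`c_mem_loc_iff₁₂/₂₁`). [cite: Kolyvagin1989Izv, §3 (the pair (E, E^D) over ℚ at l = 2)]
[cite: McCallumLMS1991, §§3–5 (Lemma 4.3, Prop. 4.4, Lemma 5.1)] [cite: GrossLMS1991, Prop. 5.4 (2)] -/
structure PairDataM (V₁ V₂ : Type*) [AddCommGroup V₁] [AddCommGroup V₂] (Pl : Type*) where
  /-- The prime `p` (any prime). -/
  p : ℕ
  /-- `p` is prime. -/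
  hp : p.Prime
  /-- The level `M`. -/
  M : ℕ
  /-- `V₁` is killed by `p^M`. -/
  torsion₁ : ∀ v : V₁, ((p : ℤ) ^ M) • v = 0
  /-- `V₂` is killed by `p^M`. -/
  torsion₂ : ∀ v : V₂, ((p : ℤ) ^ M) • v = 0
  /-- The Selmer group of the first member. -/
  Sel₁ : AddSubgroup V₁
  /-- The Selmer group of the second member. -/
  Sel₂ : AddSubgroup V₂
  /-- Local conditions of the first member. -/
  Loc₁ : Pl → AddSubgroup V₁
  /-- Local conditions of the second member. -/
  Loc₂ : Pl → AddSubgroup V₂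
  /-- `Sel₁` is cut out by its local conditions. -/
  mem_sel_iff₁ : ∀ s, s ∈ Sel₁ ↔ ∀ v, s ∈ Loc₁ v
  /-- `Sel₂` is cut out by its local conditions. -/
  mem_sel_iff₂ : ∀ s, s ∈ Sel₂ ↔ ∀ v, s ∈ Loc₂ v
  /-- Kolyvagin primes. -/
  Kol : ℕ → Prop
  /-- Kolyvagin primes are primes. -/
  prime_of_kol : ∀ ℓ, Kol ℓ → ℓ.Prime
  /-- The place of a Kolyvagin prime. -/
  pl : ℕ → Pl
  /-- "`v` divides `n`". -/
  Dv : Pl → ℕ → Prop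
  /-- `pl ℓ` is the unique place dividing `ℓ`. -/
  dv_iff : ∀ ℓ, Kol ℓ → ∀ v, Dv v ℓ ↔ v = pl ℓ
  /-- A place dividing `ℓ ℓ'` divides `ℓ` or `ℓ'`. -/
  dv_mul : ∀ ℓ ℓ', Kol ℓ → Kol ℓ' → ∀ v, Dv v (ℓ * ℓ') → Dv v ℓ ∨ Dv v ℓ'
  /-- Strict local conditions of the first member at Kolyvagin primes. -/
  A₁ : ℕ → AddSubgroup V₁
  /-- Strict local conditions of the second member at Kolyvagin primes. -/
  A₂ : ℕ → AddSubgroup V₂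
  /-- `x = δ_M x₀` on the first member. -/
  x : V₁
  /-- `x ∈ Sel₁`. -/
  x_mem : x ∈ Sel₁
  /-- `x` has order `p^M`. -/
  x_ord : ((p : ℤ) ^ (M - 1)) • x ≠ 0
  /-- `M₀`. -/
  M₀ : ℕ
  /-- Kolyvagin's classes of even depth (first member). -/
  c₁ : ℕ → V₁
  /-- Kolyvagin's classes of odd depth (second member). -/
  c₂ : ℕ → V₂
  /-- `c_M(1) = p^{M₀} x`. -/
  c_one : c₁ 1 = ((p : ℤ) ^ M₀) • x
  /-- **Lemma 4.3**, even depth. -/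
  c_mem_loc₁ : ∀ n, KolSupp Kol n → Even n.primeFactors.card → ∀ v, ¬ Dv v n → c₁ n ∈ Loc₁ v
  /-- **Lemma 4.3**, odd depth. -/
  c_mem_loc₂ : ∀ n, KolSupp Kol n → Odd n.primeFactors.card → ∀ v, ¬ Dv v n → c₂ n ∈ Loc₂ v
  /-- **Prop. 4.4** from even depth `m` to odd depth `ℓm`. -/
  c_mem_loc_iff₁₂ : ∀ ℓ m, Kol ℓ → KolSupp Kol (ℓ * m) → Even m.primeFactors.card → ∀ a : ℕ,
    (((p : ℤ) ^ a) • c₂ (ℓ * m) ∈ Loc₂ (pl ℓ)) ↔ ((p : ℤ) ^ a) • c₁ m ∈ A₁ ℓ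
  /-- **Prop. 4.4** from odd depth `m` to even depth `ℓm`. -/
  c_mem_loc_iff₂₁ : ∀ ℓ m, Kol ℓ → KolSupp Kol (ℓ * m) → Odd m.primeFactors.card → ∀ a : ℕ,
    (((p : ℤ) ^ a) • c₁ (ℓ * m) ∈ Loc₁ (pl ℓ)) ↔ ((p : ℤ) ^ a) • c₂ m ∈ A₂ ℓ

namespace PairDataM

variable {V₁ V₂ : Type*} [AddCommGroup V₁] [AddCommGroup V₂] {Pl : Type*}
variable (S : PairDataM V₁ V₂ Pl)

/-! ### The sign-indexed parts of the product -/

/-- The parts of the product indexed by a sign: `V₁ × 0` at `1`, `0 × V₂` at `−1`, `⊥` at every other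
integer (at `2`: the two members `H¹(ℚ, E^{±ε}[2^M])` of Kolyvagin's pair).
[cite: Kolyvagin1989Izv, §3 (the pair (E, E^D) over ℚ)] -/
def eig (V₁ V₂ : Type*) [AddCommGroup V₁] [AddCommGroup V₂] (ν : ℤ) : AddSubgroup (V₁ × V₂) :=
  if ν = 1 then (⊤ : AddSubgroup V₁).prod ⊥
  else if ν = -1 then (⊥ : AddSubgroup V₁).prod ⊤ else ⊥

/-- `v ∈ eig 1 ↔ v.2 = 0`. [cite: Kolyvagin1989Izv, §3 (the pair (E, E^D) over ℚ)] -/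
theorem mem_eig_one {v : V₁ × V₂} : v ∈ eig V₁ V₂ 1 ↔ v.2 = 0 := by
  simp [eig, AddSubgroup.mem_prod]

/-- `v ∈ eig (−1) ↔ v.1 = 0`. [cite: Kolyvagin1989Izv, §3 (the pair (E, E^D) over ℚ)] -/
theorem mem_eig_neg_one {v : V₁ × V₂} : v ∈ eig V₁ V₂ (-1) ↔ v.1 = 0 := by
  simp [eig, AddSubgroup.mem_prod]

/-- `eig ν = ⊥` at an integer `ν ≠ ±1`. [cite: Kolyvagin1989Izv, §3 (the pair (E, E^D) over ℚ)] -/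
theorem eig_of_ne {ν : ℤ} (h₁ : ν ≠ 1) (h₂ : ν ≠ -1) : eig V₁ V₂ ν = ⊥ := by
  rw [eig, if_neg h₁, if_neg h₂]

/-! ### Parity bookkeeping -/

/-- The class at even depth is `(c₁ n, 0)`. [cite: GrossLMS1991, Prop. 5.4 (2)] -/
theorem pairClass_of_even {n : ℕ} (h : Even n.primeFactors.card) :
    pairClass S.c₁ S.c₂ n = (S.c₁ n, 0) := by
  simp [pairClass, h]

/-- The class at odd depth is `(0, c₂ n)`. [cite: GrossLMS1991, Prop. 5.4 (2)] -/
theorem pairClass_of_odd {n : ℕ} (h : Odd n.primeFactors.card) :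
    pairClass S.c₁ S.c₂ n = (0, S.c₂ n) := by
  have h' : ¬ Even n.primeFactors.card := Nat.not_even_iff_odd.mpr h
  simp [pairClass, h']

/-- For `ℓm` a square-free product of Kolyvagin primes with `ℓ` one of them: `m` is such a product
and `r(ℓm) = r(m) + 1`. [cite: GrossLMS1991, §3 (3.1)–(3.2)] -/
theorem kolSupp_of_mul {ℓ m : ℕ} (hℓ : S.Kol ℓ) (hn : KolSupp S.Kol (ℓ * m)) :
    KolSupp S.Kol m ∧ m.primeFactors.card + 1 = (ℓ * m).primeFactors.card := by
  have hℓp := S.prime_of_kol ℓ hℓ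
  have hmem : ℓ ∈ (ℓ * m).primeFactors :=
    Nat.mem_primeFactors.mpr ⟨hℓp, dvd_mul_right ℓ m, hn.ne_zero⟩
  obtain ⟨hsupp, -, -, -, -, -, -, hcard⟩ := kolSupp_div hn hmem
  rw [Nat.mul_div_cancel_left m hℓp.pos] at hsupp hcard
  exact ⟨hsupp, hcard⟩

/-! ### The split data on the product -/

/-- **The pair data ARE split descent data on `V = V₁ × V₂`** (data carrier `SplitDataM`, no analytic
axiom): parts `eig` (`V₁ × 0`, `0 × V₂`, `⊥` elsewhere), `Sel = Sel₁ × Sel₂`, `Loc v = Loc₁ v × Loc₂ v`,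
`A ℓ = A₁ ℓ × A₂ ℓ`, `ε = 1`, `x = (x, 0)`, `c = pairClass c₁ c₂`; the tags of `x` and of `c(n)`
(Gross Prop. 5.4 (2): sign `(−1)^{r(n)}`) hold BY CONSTRUCTION, Lemma 4.3 and Prop. 4.4 are the
members' fields read through the parity of the depth. At `p = 2`: Kolyvagin's frame (Izv. 1989, §3)
for the pair `(E, E^D)` over `ℚ`, as consumed by the adaptive telescope over `SplitDataM`.
[cite: Kolyvagin1989Izv, §3] [cite: McCallumLMS1991, §§4–5 (Lemma 4.3, Prop. 4.4, Lemma 5.1)] [cite: GrossLMS1991, Prop. 5.4 (2)] -/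
def toSplitData : SplitDataM (V₁ × V₂) Pl where
  p := S.p
  hp := S.hp
  M := S.M
  torsion v := Prod.ext (S.torsion₁ v.1) (S.torsion₂ v.2)
  eig := eig V₁ V₂
  eig_disjoint v h₁ h₂ := Prod.ext (mem_eig_neg_one.mp h₂) (mem_eig_one.mp h₁)
  Sel := S.Sel₁.prod S.Sel₂
  sel_split s hs := by
    rw [AddSubgroup.mem_prod] at hs
    refine ⟨(s.1, 0), (0, s.2), ⟨?_, mem_eig_one.mpr rfl⟩, ⟨?_, mem_eig_neg_one.mpr rfl⟩,
      Prod.ext (by simp) (by simp)⟩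
    · exact AddSubgroup.mem_prod.mpr ⟨hs.1, S.Sel₂.zero_mem⟩
    · exact AddSubgroup.mem_prod.mpr ⟨S.Sel₁.zero_mem, hs.2⟩
  Loc v := (S.Loc₁ v).prod (S.Loc₂ v)
  mem_sel_iff s := by
    simp only [AddSubgroup.mem_prod, S.mem_sel_iff₁, S.mem_sel_iff₂]
    exact ⟨fun h v ↦ ⟨h.1 v, h.2 v⟩, fun h ↦ ⟨fun v ↦ (h v).1, fun v ↦ (h v).2⟩⟩
  Kol := S.Kol
  prime_of_kol := S.prime_of_kol
  pl := S.pl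
  Dv := S.Dv
  dv_iff := S.dv_iff
  dv_mul := S.dv_mul
  A ℓ := (S.A₁ ℓ).prod (S.A₂ ℓ)
  x := (S.x, 0)
  x_mem := AddSubgroup.mem_prod.mpr ⟨S.x_mem, S.Sel₂.zero_mem⟩
  x_ord h := S.x_ord (by simpa using congrArg Prod.fst h)
  M₀ := S.M₀
  ε := 1
  hε := Or.inl rfl
  x_eig := mem_eig_one.mpr rfl
  c := pairClass S.c₁ S.c₂
  c_one := by
    have h0 : Even (1 : ℕ).primeFactors.card := by simp
    rw [S.pairClass_of_even h0, S.c_one]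
    exact Prod.ext (by simp) (by simp)
  c_eig n _ := by
    rcases Nat.even_or_odd n.primeFactors.card with h | h
    · rw [S.pairClass_of_even h, h.neg_one_pow, one_mul]
      exact mem_eig_one.mpr rfl
    · rw [S.pairClass_of_odd h, h.neg_one_pow, mul_neg_one]
      exact mem_eig_neg_one.mpr rfl
  c_mem_loc n hn v hv := by
    rcases Nat.even_or_odd n.primeFactors.card with h | h
    · rw [S.pairClass_of_even h]
      exact AddSubgroup.mem_prod.mpr ⟨S.c_mem_loc₁ n hn h v hv, (S.Loc₂ v).zero_mem⟩
    · rw [S.pairClass_of_odd h]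
      exact AddSubgroup.mem_prod.mpr ⟨(S.Loc₁ v).zero_mem, S.c_mem_loc₂ n hn h v hv⟩
  c_mem_loc_iff ℓ m hℓ hn a := by
    obtain ⟨-, hcard⟩ := S.kolSupp_of_mul hℓ hn
    rcases Nat.even_or_odd m.primeFactors.card with h | h
    · have h' : Odd (ℓ * m).primeFactors.card := by rw [← hcard]; exact h.add_one
      rw [S.pairClass_of_even h, S.pairClass_of_odd h']
      simp only [Prod.smul_mk, smul_zero, AddSubgroup.mem_prod, AddSubgroup.zero_mem, true_and,
        and_true]
      exact S.c_mem_loc_iff₁₂ ℓ m hℓ hn h a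
    · have h' : Even (ℓ * m).primeFactors.card := by rw [← hcard]; exact h.add_one
      rw [S.pairClass_of_odd h, S.pairClass_of_even h']
      simp only [Prod.smul_mk, smul_zero, AddSubgroup.mem_prod, AddSubgroup.zero_mem, true_and,
        and_true]
      exact S.c_mem_loc_iff₂₁ ℓ m hℓ hn h a

/-! ### Unfolding lemmas -/

/-- `toSplitData.p = p`. [cite: McCallumLMS1991, §5] -/
@[simp] theorem toSplitData_p : S.toSplitData.p = S.p := rfl

/-- `toSplitData.M = M`. [cite: McCallumLMS1991, §5] -/
@[simp] theorem toSplitData_M : S.toSplitData.M = S.M := rfl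

/-- `toSplitData.M₀ = M₀`. [cite: McCallumLMS1991, Lemma 5.1] -/
@[simp] theorem toSplitData_M₀ : S.toSplitData.M₀ = S.M₀ := rfl

/-- `toSplitData.ε = 1` (the Heegner class sits on the first member). [cite: Kolyvagin1989Izv, §3] -/
@[simp] theorem toSplitData_ε : S.toSplitData.ε = 1 := rfl

/-- `toSplitData.x = (x, 0)`. [cite: McCallumLMS1991, Lemma 5.1] -/
@[simp] theorem toSplitData_x : S.toSplitData.x = (S.x, 0) := rfl

/-- `toSplitData.Kol = Kol`. [cite: McCallumLMS1991, §3] -/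
theorem toSplitData_kol_iff (ℓ : ℕ) : S.toSplitData.Kol ℓ ↔ S.Kol ℓ := Iff.rfl

/-- `toSplitData.pl = pl`. [cite: McCallumLMS1991, §3] -/
@[simp] theorem toSplitData_pl (ℓ : ℕ) : S.toSplitData.pl ℓ = S.pl ℓ := rfl

/-- `toSplitData.c = pairClass c₁ c₂`. [cite: GrossLMS1991, Prop. 5.4 (2)] -/
theorem toSplitData_c (n : ℕ) : S.toSplitData.c n = pairClass S.c₁ S.c₂ n := rfl

/-- The class of the product at even depth: `(c₁ n, 0)`. [cite: GrossLMS1991, Prop. 5.4 (2)] -/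
theorem toSplitData_c_of_even {n : ℕ} (h : Even n.primeFactors.card) :
    S.toSplitData.c n = (S.c₁ n, 0) :=
  S.pairClass_of_even h

/-- The class of the product at odd depth: `(0, c₂ n)`. [cite: GrossLMS1991, Prop. 5.4 (2)] -/
theorem toSplitData_c_of_odd {n : ℕ} (h : Odd n.primeFactors.card) :
    S.toSplitData.c n = (0, S.c₂ n) :=
  S.pairClass_of_odd h

/-- `v ∈ toSplitData.Sel ↔ v.1 ∈ Sel₁ ∧ v.2 ∈ Sel₂`. [cite: McCallumLMS1991, §4 (Selmer group)] -/
theorem mem_toSplitData_sel_iff (v : V₁ × V₂) : v ∈ S.toSplitData.Sel ↔ v.1 ∈ S.Sel₁ ∧ v.2 ∈ S.Sel₂ :=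
  AddSubgroup.mem_prod

/-- `v ∈ toSplitData.A ℓ ↔ v.1 ∈ A₁ ℓ ∧ v.2 ∈ A₂ ℓ`. [cite: McCallumLMS1991, §5 (19)] -/
theorem mem_toSplitData_A_iff (ℓ : ℕ) (v : V₁ × V₂) :
    v ∈ S.toSplitData.A ℓ ↔ v.1 ∈ S.A₁ ℓ ∧ v.2 ∈ S.A₂ ℓ :=
  AddSubgroup.mem_prod

/-- `v ∈ toSplitData.Loc w ↔ v.1 ∈ Loc₁ w ∧ v.2 ∈ Loc₂ w`. [cite: McCallumLMS1991, §4 (Selmer group)] -/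
theorem mem_toSplitData_loc_iff (w : Pl) (v : V₁ × V₂) :
    v ∈ S.toSplitData.Loc w ↔ v.1 ∈ S.Loc₁ w ∧ v.2 ∈ S.Loc₂ w :=
  AddSubgroup.mem_prod

/-- `toSplitData.eig = eig` (the parts of the product). [cite: Kolyvagin1989Izv, §3] -/
theorem toSplitData_eig (ν : ℤ) : S.toSplitData.eig ν = eig V₁ V₂ ν := rfl

/-- `v ∈ toSplitData.eig 1 ↔ v.2 = 0`. [cite: Kolyvagin1989Izv, §3] -/
theorem mem_toSplitData_eig_one_iff (v : V₁ × V₂) : v ∈ S.toSplitData.eig 1 ↔ v.2 = 0 :=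
  mem_eig_one

/-- `v ∈ toSplitData.eig (−1) ↔ v.1 = 0`. [cite: Kolyvagin1989Izv, §3] -/
theorem mem_toSplitData_eig_neg_one_iff (v : V₁ × V₂) : v ∈ S.toSplitData.eig (-1) ↔ v.1 = 0 :=
  mem_eig_neg_one

end PairDataM

/-! ## The forgetful map from the full pair hypotheses -/

namespace PairHypothesesM

variable {V₁ V₂ : Type*} [AddCommGroup V₁] [AddCommGroup V₂] {Pl : Type*} (S : PairHypothesesM V₁ V₂ Pl)

/-- The data underlying Kolyvagin's pair descent hypotheses (forget `duality₁`, `duality₂`,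
`cebotarev`). [cite: McCallumLMS1991, §§3–5] -/
def toData : PairDataM V₁ V₂ Pl where
  p := S.p
  hp := S.hp
  M := S.M
  torsion₁ := S.torsion₁
  torsion₂ := S.torsion₂
  Sel₁ := S.Sel₁
  Sel₂ := S.Sel₂
  Loc₁ := S.Loc₁
  Loc₂ := S.Loc₂
  mem_sel_iff₁ := S.mem_sel_iff₁
  mem_sel_iff₂ := S.mem_sel_iff₂
  Kol := S.Kol
  prime_of_kol := S.prime_of_kol
  pl := S.pl
  Dv := S.Dv
  dv_iff := S.dv_iff
  dv_mul := S.dv_mul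
  A₁ := S.A₁
  A₂ := S.A₂
  x := S.x
  x_mem := S.x_mem
  x_ord := S.x_ord
  M₀ := S.M₀
  c₁ := S.c₁
  c₂ := S.c₂
  c_one := S.c_one
  c_mem_loc₁ := S.c_mem_loc₁
  c_mem_loc₂ := S.c_mem_loc₂
  c_mem_loc_iff₁₂ := S.c_mem_loc_iff₁₂
  c_mem_loc_iff₂₁ := S.c_mem_loc_iff₂₁

end PairHypothesesM

end KolyvaginDescent

end Literature.NumberTheory.EllipticCurves

end
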